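import Summits.ResolutionOfSingularities.ResolutionOfSingularities.Theorems.FrobeniusLadderFInjectiveMacaulayficationCNConeFiModelPrime
import HarnessLib

/-!
# (H3-rel) THE CN ENGINE RELATIVE TO A COORDINATE STRATUM `V(X_J)` — `cnConeFiModelRel`
# (crux `FInjectiveMacaulayfication` stmt-ResolutionOfSingularities-15315, chain w45a; res-L1-w45a-plan-1 RULINGS R7.4
# 2026-08-27T04:26:37Z «(H3-rel) `stub_cnConeFiModelRel` = the CN engine RELATIVE to a coordinate stratum J ⊆ Fin n (centre =
# monomial ideal in the J-variables, (prim) on J only, hoff off V(X_J), Cartier–Newton faces positive on J; first PRODUCER of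
# STRONG⁺ steps for X₁ ≅ V(f) × 𝔸ˢ-type strata; proof = G4ᴾ/G5ᴾ with Fin n ↦ J)»)

Support file for crux stmt-ResolutionOfSingularities-15315 (`FrobeniusLadder.FInjectiveMacaulayfication`), chain w45a, seat
res-D-pv-017 AS res-L1-w45a-stub-5 (D→L conversion 2026-08-27T04:22Z). [OURS · L1 W4.5a] — NOT a statement of any manuscript;
AI-written, weaker than expert review.

THE RELATIVE MONOMIAL BLOW-UP ENGINE. `R = k[X]/(f)` with `(f)` prime and no `x̄ⱼ = 0`; `J ⊆ Fin n` a NON-EMPTY set of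
coordinates (the stratum is `V(X_J) ∩ Spec R`); `A` a finite set of non-zero exponents EACH INVOLVING A `J`-VARIABLE (so the centre
`I_A R` is cosupported on `V(X_J)`), containing a pure power `X_j^e` for every `j ∈ J` ((prim) ON `J` ONLY); unimodular vertex charts
`x^{m_c}` covering `I_A` as in G5ᴾ. HYPOTHESES off the stratum and on the faces: the Cohen–Macaulay + Frobenius-closed clause at the
maximal ideals of `R` OFF `V(X_J)` (some `x̄ⱼ ∉ Q`, `j ∈ J`), and Cartier–Newton nondegeneracy in Fedder form for every row-subset
weight `w_S = Σ_(i ∈ S) v_i` that is STRICTLY POSITIVE ON `J` (no condition on the coordinates outside `J`). CONCLUSION: the G5ᴾ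
conclusion verbatim — `Spec R` has a proper birational model (the blow-up of `I_A R`) all of whose stalks are domains satisfying the
crux clause. With `J = Fin n` this is exactly G5ᴾ `CNConeFiModelPrime.cnConeFiModel_of_isPrime` (p496198).

Proof = the landed G4ᴾ (`CNChartClause.cnChartClause` p494458) and G5ᴾ (p495573 / p496198) with `Fin n ↦ J` in four places:
(1) the Jacobson step off the centre gives a maximal `Q ⊇ P` missing some `x̄ⱼ`, `j ∈ J` (`exists_maximal_not_mem_X_of_le`, as
`I_A R ⊆ (x̄ⱼ : j ∈ J)`); (2) in a vertex chart a maximal `Q ∋ x̄^{m_c}/1` contains `θ(Xⱼ)` for `j ∈ J` only ((prim) on `J`);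
(3) so the vanishing set `S` of the chart coordinates at `Q` meets every column `j ∈ J` of `V` (`w_S` positive ON `J`, `S ≠ ∅` as
`J ≠ ∅`); (4) the Cartier–Newton hypothesis is asked exactly for such `S`. C1 p495258, C2 p490448, C3a p492570, Fedder at a maximal
ideal, E6‴ `BlowupFiModelOfCover` + `ReesCoverOfPowers` are called unchanged. Decls: `exists_maximal_not_mem_X_of_le`,
`cnChartClauseRel` (G4ᴾ-rel), `cnConeFiModelRel_of_chartClause` (G5ᴾ-rel core), `cnConeFiModelRel` (G5ᴾ-rel = H3-rel).
No definitions, no named facts; glue over landed files. [folklore]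
-/

-- single-problem summit: the doubled namespace component is forced
set_option linter.dupNamespace false

noncomputable section

open AlgebraicGeometry CategoryTheory Literature.AlgebraicGeometry.Resolution MvPolynomial

namespace Summit.ResolutionOfSingularities.ResolutionOfSingularities.Theorems.FInjectiveMacaulayfication.CNConeFiModelRel

open Summit.ResolutionOfSingularities.ResolutionOfSingularities.Theorems.FInjectiveMacaulayfication
open Literature.RingTheory.TightClosure

/-! ## §0 The Jacobson step relative to `J` -/

/-- In the Jacobson ring `k[X]/(f)`: if `I ⊆ (x̄ⱼ : j ∈ J)` and a prime `P` does not contain `I`, some maximal `Q ⊇ P` misses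
some `x̄ⱼ` with `j ∈ J` (G5ᴾ's `WeightedConeCore.exists_maximal_not_mem_X` with `Fin n ↦ J`). [folklore] -/
theorem exists_maximal_not_mem_X_of_le {k : Type} [Field k] {n : ℕ} (f : MvPolynomial (Fin n) k) (J : Finset (Fin n))
    (I : Ideal (MvPolynomial (Fin n) k ⧸ Ideal.span {f}))
    (hI : I ≤ Ideal.span ((fun j : Fin n => Ideal.Quotient.mk (Ideal.span {f}) (X j)) '' (J : Set (Fin n))))
    (P : Ideal (MvPolynomial (Fin n) k ⧸ Ideal.span {f})) [P.IsPrime] (hP : ¬ I ≤ P) :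
    ∃ (Q : Ideal (MvPolynomial (Fin n) k ⧸ Ideal.span {f})), Q.IsMaximal ∧ P ≤ Q ∧
      ∃ j ∈ J, Ideal.Quotient.mk (Ideal.span {f}) (X j) ∉ Q := by
  by_contra hcon
  push Not at hcon
  apply hP
  have hJ : P.jacobson = P := IsJacobsonRing.out inferInstance (Ideal.IsPrime.isRadical ‹_›)
  refine hI.trans ?_
  rw [← hJ, Ideal.jacobson, Ideal.span_le]
  rintro _ ⟨j, hj, rfl⟩
  simp only [SetLike.mem_coe, Ideal.mem_sInf, Set.mem_setOf_eq]
  rintro Q ⟨hPQ, hQ⟩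
  exact hcon Q hQ hPQ j hj

/-! ## §1 (G4ᴾ-rel) the chart clause at maximal ideals containing `θ(Xⱼ)` for `j ∈ J` -/

/-- **(G4ᴾ-rel) THE CN CHART CLAUSE OVER THE STRATUM.** One vertex chart `θ : Xⱼ ↦ ∏ᵢ yᵢ^(V i j)` (`V` unimodular),
`θ f = y^d · g`, `(g)` prime, `g ≠ 0`; Cartier–Newton nondegeneracy in Fedder form for every row-subset weight `w_S` that is
strictly positive ON `J`; a simultaneous minimiser of all rows on `supp f`. Then `k[y]/(g)` satisfies the Cohen–Macaulay +
Frobenius-closed clause at every maximal `Q` containing `θ(Xⱼ)` for all `j ∈ J` (`J ≠ ∅`). Proof = `CNChartClause.cnChartClause`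
(p494458) verbatim except that the vanishing set `S` of the coordinates at `Q` is only shown to meet the columns `j ∈ J`. [folklore] -/
theorem cnChartClauseRel : ∀ (p : ℕ) [Fact p.Prime] (k : Type) [Field k] [CharP k p] (n : ℕ) (J : Finset (Fin n)), J.Nonempty →
    ∀ (f : MvPolynomial (Fin n) k) (V : Matrix (Fin n) (Fin n) ℕ), IsUnit (V.map (Nat.cast : ℕ → ℤ)).det →
    ∀ (d : Fin n →₀ ℕ) (g : MvPolynomial (Fin n) k), (Ideal.span {g}).IsPrime →
    MvPolynomial.aeval (fun j : Fin n => ∏ i : Fin n, (MvPolynomial.X i : MvPolynomial (Fin n) k) ^ V i j) f = MvPolynomial.monomial d 1 * g → g ≠ 0 →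
    (∀ S : Finset (Fin n), (∀ j ∈ J, 0 < ∑ i ∈ S, V i j) →
      (∀ D : ℕ, (MvPolynomial.weightedHomogeneousComponent (fun j : Fin n => ∑ i ∈ S, V i j) D f ≠ 0 ∧
          ∀ D' < D, MvPolynomial.weightedHomogeneousComponent (fun j : Fin n => ∑ i ∈ S, V i j) D' f = 0) →
        ∀ (K : Type) [Field K] [Algebra k K] (b : Fin n → K), (∀ i, b i ≠ 0) →
          MvPolynomial.aeval b (MvPolynomial.weightedHomogeneousComponent (fun j : Fin n => ∑ i ∈ S, V i j) D f) = 0 →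
          (MvPolynomial.map (algebraMap k K) (MvPolynomial.weightedHomogeneousComponent (fun j : Fin n => ∑ i ∈ S, V i j) D f)) ^ (p - 1) ∉
            Ideal.span (Set.range fun i : Fin n => (MvPolynomial.X i - MvPolynomial.C (b i)) ^ p))) →
    (∃ m ∈ f.support, ∀ i : Fin n, ∑ j : Fin n, V i j * m j = d i) →
    ∀ (Q : Ideal (MvPolynomial (Fin n) k ⧸ Ideal.span {g})) [Q.IsMaximal],
    (∀ j ∈ J, Ideal.Quotient.mk (Ideal.span {g}) (∏ i : Fin n, MvPolynomial.X i ^ V i j) ∈ Q) →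
    ∀ d : ℕ, ringKrullDim (Localization.AtPrime Q) = d → ∀ s : Fin d → Localization.AtPrime Q,
        (Ideal.span (Set.range s)).radical.IsMaximal →
          RingTheory.Sequence.IsWeaklyRegular (Localization.AtPrime Q) (List.ofFn s) ∧
          ∀ y : Localization.AtPrime Q, (∃ e : ℕ, y ^ p ^ e ∈ Ideal.span
            ((fun z : Localization.AtPrime Q => z ^ p ^ e) ''
              (Ideal.span (Set.range s) : Set (Localization.AtPrime Q)))) → y ∈ Ideal.span (Set.range s) := by
  intro p _ k _ _ n J hJ f V hV dv g hgp hθ hg0 hCN hface Q _ hXQ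
  classical
  -- the contraction `P` of `Q` to `k[y]`, its residue field `K` and the tautological point `a`
  set P : Ideal (MvPolynomial (Fin n) k) := Q.comap (Ideal.Quotient.mk (Ideal.span {g})) with hP_def
  haveI hPmax : P.IsMaximal := Ideal.comap_isMaximal_of_surjective _ Ideal.Quotient.mk_surjective
  letI : Field (MvPolynomial (Fin n) k ⧸ P) := Ideal.Quotient.field P
  haveI : CharP (MvPolynomial (Fin n) k ⧸ P) p :=
    charP_of_injective_algebraMap (algebraMap k (MvPolynomial (Fin n) k ⧸ P)).injective p
  have hgP : g ∈ P := by
    rw [hP_def, Ideal.mem_comap, Ideal.Quotient.eq_zero_iff_mem.mpr (Ideal.mem_span_singleton_self g)]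
    exact Q.zero_mem
  -- `aeval a = mk_P` on `k[y]`
  have haev : ∀ q : MvPolynomial (Fin n) k,
      MvPolynomial.aeval (fun i : Fin n => Ideal.Quotient.mk P (MvPolynomial.X i)) q = Ideal.Quotient.mk P q := by
    intro q
    have h : (MvPolynomial.aeval (R := k) (fun i : Fin n => Ideal.Quotient.mk P (MvPolynomial.X i))) =
        Ideal.Quotient.mkₐ k P := MvPolynomial.algHom_ext fun i => by
      rw [MvPolynomial.aeval_X, Ideal.Quotient.mkₐ_eq_mk]
    rw [h, Ideal.Quotient.mkₐ_eq_mk]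
  have ha : MvPolynomial.aeval (fun i : Fin n => Ideal.Quotient.mk P (MvPolynomial.X i)) g = 0 := by
    rw [haev, Ideal.Quotient.eq_zero_iff_mem]
    exact hgP
  -- the vanishing set `S` of the coordinates: every column `j ∈ J` of `V` meets it, and it is non-empty (`J ≠ ∅`)
  set S : Finset (Fin n) := Finset.univ.filter fun i => Ideal.Quotient.mk P (MvPolynomial.X i) = 0 with hS_def
  have hS : ∀ i, i ∈ S ↔ Ideal.Quotient.mk P (MvPolynomial.X i) = 0 := fun i => by
    rw [hS_def, Finset.mem_filter]
    exact ⟨fun h => h.2, fun h => ⟨Finset.mem_univ i, h⟩⟩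
  have hcol : ∀ j ∈ J, ∃ i ∈ S, 0 < V i j := by
    intro j hj
    have h1 : Ideal.Quotient.mk P (∏ i : Fin n, MvPolynomial.X i ^ V i j) = 0 := by
      rw [Ideal.Quotient.eq_zero_iff_mem, hP_def, Ideal.mem_comap]
      exact hXQ j hj
    rw [map_prod, Finset.prod_eq_zero_iff] at h1
    obtain ⟨i, -, hi⟩ := h1
    rw [map_pow] at hi
    have hV0 : V i j ≠ 0 := by
      intro h0
      rw [h0, pow_zero] at hi
      exact one_ne_zero hi
    exact ⟨i, (hS i).mpr (pow_eq_zero_iff hV0 |>.mp hi), Nat.pos_of_ne_zero hV0⟩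
  have hSpos : ∀ j ∈ J, 0 < ∑ i ∈ S, V i j := by
    intro j hj
    obtain ⟨i, hi, hVij⟩ := hcol j hj
    exact lt_of_lt_of_le hVij (Finset.single_le_sum (fun i _ => Nat.zero_le (V i j)) hi)
  have hSne : S.Nonempty := by
    obtain ⟨j₀, hj₀⟩ := hJ
    obtain ⟨i, hi, -⟩ := hcol j₀ hj₀
    exact ⟨i, hi⟩
  -- C2: Fedder's test for `g ⊗ K` at `a`
  have hfedK := ToricChartFedderAssembly.toricChart_fedder p f V hV dv g hθ (MvPolynomial (Fin n) k ⧸ P)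
    (fun i : Fin n => Ideal.Quotient.mk P (MvPolynomial.X i)) S hS hSne (hCN S hSpos)
    (by obtain ⟨m, hm, hmin⟩ := hface; exact ⟨m, hm, fun i _ => hmin i⟩) ha
  -- C3a: `g^(p-1) ∉ P^[p]`
  have hfrob := FrobeniusPowerOfFedderAt.frobeniusPower_of_fedderAt p k n g P hfedK
  -- generators of `P` and Fedder at the maximal ideal
  obtain ⟨m, gens, hgens⟩ := Submodule.fg_iff_exists_fin_generating_family.mp ((isNoetherianRing_iff_ideal_fg _).mp inferInstance P)
  have hfed : g ^ (p - 1) ∉ Ideal.span (Set.range fun i : Fin m => gens i ^ p) := by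
    intro h
    apply hfrob
    refine (Ideal.span_le.mpr ?_) h
    rintro _ ⟨i, rfl⟩
    exact pow_mem_frobeniusPower (by rw [← hgens]; exact Submodule.subset_span ⟨i, rfl⟩)
  exact FedderAtMaximalIdeal.stub_fedderAtMaximalIdeal p k n m gens g Q hgens.symm hg0 hfed

/-! ## §2 (G5ᴾ-rel core) the blow-up of a `J`-supported monomial ideal from chartwise certificates -/

/-- **(G5ᴾ-rel core) THE RELATIVE MONOMIAL BLOW-UP ENGINE, CORE FORM.** `A` a finite set of non-zero exponents each involving a
variable of `J` (`∃ j ∈ J, 0 < a j`), `I_A` the monomial ideal it generates, vertex exponents `m_c ∈ A` whose charts cover,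
`(f)` prime with all `x̄ⱼ ≠ 0`; if `R = k[X]/(f)` satisfies the clause at the maximal ideals OFF `V(X_J)` and every affine blow-up
algebra `R[I_A R/x̄^{m_c}]` satisfies the Cohen–Macaulay + Frobenius-closed clause at its maximal ideals containing `x̄^{m_c}`, then
`Spec R` admits the crux's model. Proof = `CNConeFiModel.cnConeFiModel_of_chartClause` (p495573) with the Jacobson step relative to
`J` (`exists_maximal_not_mem_X_of_le`, using `I_A R ⊆ (x̄ⱼ : j ∈ J)`). [folklore] -/
theorem cnConeFiModelRel_of_chartClause (p : ℕ) [Fact p.Prime] (k : Type) [Field k] [CharP k p] (n : ℕ) (J : Finset (Fin n))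
    (A : Finset (Fin n →₀ ℕ)) (hAJ : ∀ a ∈ A, ∃ j ∈ J, 0 < a j)
    (t : ℕ) (ht : 0 < t) (m : Fin t → (Fin n →₀ ℕ)) (hm : ∀ c : Fin t, m c ∈ A)
    (hcov : ∀ a ∈ A, ∃ (c : Fin t) (K : ℕ), 1 ≤ K ∧ ∃ y ∈ (Ideal.span ((fun b : Fin n →₀ ℕ => (MvPolynomial.monomial b (1 : k) : MvPolynomial (Fin n) k)) '' (A : Set (Fin n →₀ ℕ)))) ^ (K - 1),
      (MvPolynomial.monomial a (1 : k) : MvPolynomial (Fin n) k) ^ K = MvPolynomial.monomial (m c) 1 * y)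
    (f : MvPolynomial (Fin n) k) (hfprime : (Ideal.span {f}).IsPrime)
    (hXne : ∀ v : Fin n, Ideal.Quotient.mk (Ideal.span {f}) (MvPolynomial.X v) ≠ 0)
    (hoff : ∀ (Q : Ideal (MvPolynomial (Fin n) k ⧸ Ideal.span {f})) [Q.IsMaximal],
      (∃ j ∈ J, Ideal.Quotient.mk (Ideal.span {f}) (MvPolynomial.X j) ∉ Q) →
      ∀ d : ℕ, ringKrullDim (Localization.AtPrime Q) = d → ∀ s : Fin d → Localization.AtPrime Q,
        (Ideal.span (Set.range s)).radical.IsMaximal →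
          RingTheory.Sequence.IsWeaklyRegular (Localization.AtPrime Q) (List.ofFn s) ∧
          ∀ y : Localization.AtPrime Q, (∃ e : ℕ, y ^ p ^ e ∈ Ideal.span
            ((fun z : Localization.AtPrime Q => z ^ p ^ e) ''
              (Ideal.span (Set.range s) : Set (Localization.AtPrime Q)))) → y ∈ Ideal.span (Set.range s))
    (hon : ∀ (c : Fin t) (Q : Ideal (blowupAlgebra (Ideal.span ((fun b : Fin n →₀ ℕ => Ideal.Quotient.mk (Ideal.span {f}) (MvPolynomial.monomial b (1 : k))) '' (A : Set (Fin n →₀ ℕ)))) (Ideal.Quotient.mk (Ideal.span {f}) (MvPolynomial.monomial (m c) 1)))) [Q.IsMaximal],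
      algebraMap (MvPolynomial (Fin n) k ⧸ Ideal.span {f}) (blowupAlgebra (Ideal.span ((fun b : Fin n →₀ ℕ => Ideal.Quotient.mk (Ideal.span {f}) (MvPolynomial.monomial b (1 : k))) '' (A : Set (Fin n →₀ ℕ)))) (Ideal.Quotient.mk (Ideal.span {f}) (MvPolynomial.monomial (m c) 1))) (Ideal.Quotient.mk (Ideal.span {f}) (MvPolynomial.monomial (m c) 1)) ∈ Q →
      ∀ d : ℕ, ringKrullDim (Localization.AtPrime Q) = d → ∀ s : Fin d → Localization.AtPrime Q,
        (Ideal.span (Set.range s)).radical.IsMaximal →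
          RingTheory.Sequence.IsWeaklyRegular (Localization.AtPrime Q) (List.ofFn s) ∧
          ∀ y : Localization.AtPrime Q, (∃ e : ℕ, y ^ p ^ e ∈ Ideal.span
            ((fun z : Localization.AtPrime Q => z ^ p ^ e) ''
              (Ideal.span (Set.range s) : Set (Localization.AtPrime Q)))) → y ∈ Ideal.span (Set.range s)) :
    ∃ (X' : Scheme.{0}) (π : X' ⟶ Spec (.of (MvPolynomial (Fin n) k ⧸ Ideal.span {f}))), IsProper π ∧
      Literature.AlgebraicGeometry.Resolution.IsBirational π ∧
      ∀ y : X', IsDomain (X'.presheaf.stalk y) ∧ ∀ d : ℕ, ringKrullDim (X'.presheaf.stalk y) = d →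
        ∀ s : Fin d → X'.presheaf.stalk y, (Ideal.span (Set.range s)).radical.IsMaximal →
          RingTheory.Sequence.IsWeaklyRegular (X'.presheaf.stalk y) (List.ofFn s) ∧
          ∀ z : X'.presheaf.stalk y, (∃ e : ℕ, z ^ p ^ e ∈
              Ideal.span ((fun w : X'.presheaf.stalk y => w ^ p ^ e) ''
                (Ideal.span (Set.range s) : Set (X'.presheaf.stalk y)))) →
            z ∈ Ideal.span (Set.range s) := by
  haveI := hfprime
  haveI : IsDomain (MvPolynomial (Fin n) k ⧸ Ideal.span {f}) := Ideal.Quotient.isDomain _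
  haveI : CharP (MvPolynomial (Fin n) k ⧸ Ideal.span {f}) p :=
    charP_of_injective_algebraMap (algebraMap k (MvPolynomial (Fin n) k ⧸ Ideal.span {f})).injective p
  -- names: the centre `I = I_A · R` and the covering sub-family `v c = x̄ ^ (m c)`
  obtain ⟨I, hI⟩ : ∃ I : Ideal (MvPolynomial (Fin n) k ⧸ Ideal.span {f}), I = Ideal.span ((fun b : Fin n →₀ ℕ => Ideal.Quotient.mk (Ideal.span {f}) (MvPolynomial.monomial b (1 : k))) '' (A : Set (Fin n →₀ ℕ))) := ⟨_, rfl⟩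
  -- the same ideal written as an extension
  have hImap : I = (Ideal.span ((fun b : Fin n →₀ ℕ => (MvPolynomial.monomial b (1 : k) : MvPolynomial (Fin n) k)) '' (A : Set (Fin n →₀ ℕ)))).map (Ideal.Quotient.mk (Ideal.span {f})) := by
    rw [hI, Ideal.map_span, Set.image_image]
  obtain ⟨v, hv⟩ : ∃ v : Fin t → MvPolynomial (Fin n) k ⧸ Ideal.span {f},
      v = fun c => Ideal.Quotient.mk (Ideal.span {f}) (MvPolynomial.monomial (m c) 1) := ⟨_, rfl⟩
  have hvI : ∀ c : Fin t, v c ∈ I := by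
    intro c
    rw [hv, hI]
    exact Ideal.subset_span ⟨m c, hm c, rfl⟩
  have hv0 : ∀ c : Fin t, v c ≠ 0 := fun c => by
    rw [hv]
    exact CNConeFiModel.mk_monomial_ne_zero f hXne (m c)
  have hI0 : I ≠ ⊥ := fun h => hv0 ⟨0, ht⟩ (by simpa [h] using hvI ⟨0, ht⟩)
  -- the centre lies in the ideal of the `J`-variables (every generator involves a `J`-variable)
  have hIle : I ≤ Ideal.span ((fun j : Fin n => Ideal.Quotient.mk (Ideal.span {f}) (MvPolynomial.X j)) '' (J : Set (Fin n))) := by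
    rw [hImap, show ((fun j : Fin n => Ideal.Quotient.mk (Ideal.span {f}) (MvPolynomial.X j)) '' (J : Set (Fin n))) =
      Ideal.Quotient.mk (Ideal.span {f}) '' ((fun j : Fin n => (X j : MvPolynomial (Fin n) k)) '' (J : Set (Fin n))) from
      by rw [Set.image_image], ← Ideal.map_span]
    refine Ideal.map_mono ?_
    rw [Ideal.span_le]
    rintro _ ⟨b, hb, rfl⟩
    obtain ⟨j, hj, hbj⟩ := hAJ b hb
    -- `x^b = X_j · x^(b - e_j)`
    have hXj : (X j : MvPolynomial (Fin n) k) ∈ Ideal.span ((fun j : Fin n => (X j : MvPolynomial (Fin n) k)) '' (J : Set (Fin n))) :=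
      Ideal.subset_span ⟨j, hj, rfl⟩
    have hle : Finsupp.single j 1 ≤ b := by
      rw [Finsupp.single_le_iff]
      exact hbj
    have heq : (MvPolynomial.monomial b (1 : k) : MvPolynomial (Fin n) k) =
        MvPolynomial.monomial (b - Finsupp.single j 1) (1 : k) * X j := by
      rw [X, monomial_mul, mul_one, tsub_add_cancel_of_le hle]
    show (MvPolynomial.monomial b (1 : k) : MvPolynomial (Fin n) k) ∈
      Ideal.span ((fun j : Fin n => (X j : MvPolynomial (Fin n) k)) '' (J : Set (Fin n)))
    rw [heq]
    exact Ideal.mul_mem_left _ _ hXj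
  -- THE COVER, read off the identities `(x^a)^K = x^(m c) · y`
  have hcov' : (HomogeneousIdeal.irrelevant (reesGrading I)).toIdeal ≤
      (Ideal.span (Set.range fun c : Fin t => reesT (I := I) (v c) (hvI c))).radical := by
    refine ReesCoverOfPowers.stub_reesCoverOfPowers _ I (Ideal.Quotient.mk (Ideal.span {f}) '' ((fun b : Fin n →₀ ℕ => (MvPolynomial.monomial b (1 : k) : MvPolynomial (Fin n) k)) '' (A : Set (Fin n →₀ ℕ)))) (by rw [hImap, Ideal.map_span]) t v hvI ?_
    rintro _ ⟨_, ⟨a, ha, rfl⟩, rfl⟩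
    obtain ⟨c, K, hK, y, hy, hEq⟩ := hcov a ha
    refine ⟨c, K, hK, Ideal.Quotient.mk (Ideal.span {f}) y, ?_, ?_⟩
    · rw [hImap, ← Ideal.map_pow]
      exact Ideal.mem_map_of_mem _ hy
    · rw [hv]
      show _ = Ideal.Quotient.mk (Ideal.span {f}) (MvPolynomial.monomial (m c) 1) * _
      rw [← map_pow, hEq, map_mul]
  -- OFF THE CENTRE (Jacobson, relative to `J`)
  have hoff' : ∀ (P : Ideal (MvPolynomial (Fin n) k ⧸ Ideal.span {f})) [P.IsPrime], ¬ I ≤ P →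
      IsDomain (Localization.AtPrime P) ∧
      ∀ d : ℕ, ringKrullDim (Localization.AtPrime P) = d → ∀ s : Fin d → Localization.AtPrime P,
        (Ideal.span (Set.range s)).radical.IsMaximal →
          RingTheory.Sequence.IsWeaklyRegular (Localization.AtPrime P) (List.ofFn s) ∧
          ∀ y : Localization.AtPrime P, (∃ e : ℕ, y ^ p ^ e ∈ Ideal.span
            ((fun z : Localization.AtPrime P => z ^ p ^ e) ''
              (Ideal.span (Set.range s) : Set (Localization.AtPrime P)))) → y ∈ Ideal.span (Set.range s) := by
    intro P _ hP
    obtain ⟨Q, hQ, hPQ, j, hj, hjQ⟩ := exists_maximal_not_mem_X_of_le f J I hIle P hP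
    haveI := hQ
    exact ClauseOfMaximal.fiClause_atPrime_of_le p hPQ ⟨inferInstance, hoff Q ⟨j, hj, hjQ⟩⟩
  -- ON THE EXCEPTIONAL LOCUS, chart by chart
  have hon' : ∀ (c : Fin t) (Q : Ideal (blowupAlgebra I (v c))) [Q.IsMaximal],
      algebraMap (MvPolynomial (Fin n) k ⧸ Ideal.span {f}) (blowupAlgebra I (v c)) (v c) ∈ Q →
      ∀ d : ℕ, ringKrullDim (Localization.AtPrime Q) = d → ∀ s : Fin d → Localization.AtPrime Q,
        (Ideal.span (Set.range s)).radical.IsMaximal →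
          RingTheory.Sequence.IsWeaklyRegular (Localization.AtPrime Q) (List.ofFn s) ∧
          ∀ y : Localization.AtPrime Q, (∃ e : ℕ, y ^ p ^ e ∈ Ideal.span
            ((fun z : Localization.AtPrime Q => z ^ p ^ e) ''
              (Ideal.span (Set.range s) : Set (Localization.AtPrime Q)))) → y ∈ Ideal.span (Set.range s) := by
    subst hI hv
    intro c Q _ hQ
    exact hon c Q hQ
  exact BlowupFiModelOfCover.stub_blowupFiModelOfCover p (MvPolynomial (Fin n) k ⧸ Ideal.span {f}) I t v
    hvI hI0 hv0 hcov' hoff' hon'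

/-! ## §3 (G5ᴾ-rel = H3-rel) the global relative statement, an unconditional theorem schema -/

set_option maxHeartbeats 800000 in
/-- **(H3-rel) `cnConeFiModelRel` — THE CN ENGINE RELATIVE TO A COORDINATE STRATUM: A THEOREM.** Data as in G5ᴾ
(`CNConeFiModelPrime.cnConeFiModel_of_isPrime`, p496198) except: `J ⊆ Fin n` non-empty; every exponent of `A` involves a `J`-variable;
(prim) is asked ON `J` ONLY (`X_j^e ∈ A` for `j ∈ J`); the clause off the centre is asked only at the maximal ideals OFF `V(X_J)`; the
Cartier–Newton faces are those of the row-subset weights strictly positive ON `J`. Conclusion = G5ᴾ's: `Spec k[X]/(f)` admits a proper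
birational model all of whose stalks are domains satisfying the crux clause (the blow-up of `I_A R`, covered by the vertex charts).
Per chart the landed prime presentation `k[y]/(g_c) ≃ R[I_A R/x̄^(m_c)]` (p495258) pulls a maximal `Q ∋ x̄^(m_c)/1` back to a maximal
`Q'` containing `θ(X_j)` for `j ∈ J` ((prim) on `J`: `(x̄ⱼ/1)^ε = (x̄ⱼ^ε/x̄^(m_c))·(x̄^(m_c)/1) ∈ Q`), the clause at `Q'` is
(G4ᴾ-rel) `cnChartClauseRel`, transported along the localised equivalence; then §2. [folklore] -/
theorem cnConeFiModelRel :
    ∀ (p : ℕ) [Fact p.Prime] (k : Type) [Field k] [CharP k p] (n : ℕ) (J : Finset (Fin n)), J.Nonempty →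
    ∀ (A : Finset (Fin n →₀ ℕ)), (∀ a ∈ A, ∃ j ∈ J, 0 < a j) →
    (∀ j ∈ J, ∃ e : ℕ, 0 < e ∧ Finsupp.single j e ∈ A) →
    ∀ (t : ℕ), 0 < t → ∀ (V : Fin t → Matrix (Fin n) (Fin n) ℕ), (∀ c, IsUnit ((V c).map (Nat.cast : ℕ → ℤ)).det) →
    ∀ (m : Fin t → (Fin n →₀ ℕ)), (∀ c, m c ∈ A) →
    ∀ (a : Fin t → Fin n → (Fin n →₀ ℕ)), (∀ c i, a c i ∈ A) →
    (∀ (c : Fin t) (i : Fin n), (Finsupp.equivFunOnFinite.symm ((V c).mulVec ⇑(a c i)) : Fin n →₀ ℕ) =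
      Finsupp.equivFunOnFinite.symm ((V c).mulVec ⇑(m c)) + Finsupp.single i 1) →
    (∀ (c : Fin t), ∀ e ∈ A, (Finsupp.equivFunOnFinite.symm ((V c).mulVec ⇑(m c)) : Fin n →₀ ℕ) ≤
      Finsupp.equivFunOnFinite.symm ((V c).mulVec ⇑e)) →
    (∀ e ∈ A, ∃ (c : Fin t) (K : ℕ), 1 ≤ K ∧ ∃ y ∈ (Ideal.span ((fun b : Fin n →₀ ℕ => (MvPolynomial.monomial b (1 : k) : MvPolynomial (Fin n) k)) '' (A : Set (Fin n →₀ ℕ)))) ^ (K - 1),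
      (MvPolynomial.monomial e (1 : k) : MvPolynomial (Fin n) k) ^ K = MvPolynomial.monomial (m c) 1 * y) →
    ∀ (f : MvPolynomial (Fin n) k), (Ideal.span {f}).IsPrime →
    (∀ v : Fin n, Ideal.Quotient.mk (Ideal.span {f}) (MvPolynomial.X v) ≠ 0) →
    (∀ (Q : Ideal (MvPolynomial (Fin n) k ⧸ Ideal.span {f})) [Q.IsMaximal],
      (∃ j ∈ J, Ideal.Quotient.mk (Ideal.span {f}) (MvPolynomial.X j) ∉ Q) →
      ∀ d : ℕ, ringKrullDim (Localization.AtPrime Q) = d → ∀ s : Fin d → Localization.AtPrime Q,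
        (Ideal.span (Set.range s)).radical.IsMaximal →
          RingTheory.Sequence.IsWeaklyRegular (Localization.AtPrime Q) (List.ofFn s) ∧
          ∀ y : Localization.AtPrime Q, (∃ e : ℕ, y ^ p ^ e ∈ Ideal.span
            ((fun z : Localization.AtPrime Q => z ^ p ^ e) ''
              (Ideal.span (Set.range s) : Set (Localization.AtPrime Q)))) → y ∈ Ideal.span (Set.range s)) →
    (∀ (c : Fin t) (S : Finset (Fin n)), (∀ j ∈ J, 0 < ∑ i ∈ S, V c i j) →
      (∀ D : ℕ, (MvPolynomial.weightedHomogeneousComponent (fun j : Fin n => ∑ i ∈ S, V c i j) D f ≠ 0 ∧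
          ∀ D' < D, MvPolynomial.weightedHomogeneousComponent (fun j : Fin n => ∑ i ∈ S, V c i j) D' f = 0) →
        ∀ (K : Type) [Field K] [Algebra k K] (b : Fin n → K), (∀ i, b i ≠ 0) →
          MvPolynomial.aeval b (MvPolynomial.weightedHomogeneousComponent (fun j : Fin n => ∑ i ∈ S, V c i j) D f) = 0 →
          (MvPolynomial.map (algebraMap k K) (MvPolynomial.weightedHomogeneousComponent (fun j : Fin n => ∑ i ∈ S, V c i j) D f)) ^ (p - 1) ∉
            Ideal.span (Set.range fun i : Fin n => (MvPolynomial.X i - MvPolynomial.C (b i)) ^ p))) →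
    ∀ (dv : Fin t → (Fin n →₀ ℕ)) (g : Fin t → MvPolynomial (Fin n) k),
    (∀ c, MvPolynomial.aeval (fun j : Fin n => ∏ i : Fin n, (MvPolynomial.X i : MvPolynomial (Fin n) k) ^ V c i j) f = MvPolynomial.monomial (dv c) 1 * g c) →
    (∀ c, ∀ i : Fin n, ¬ (MvPolynomial.X i ∣ g c)) →
    (∀ c, ∃ m ∈ f.support, ∀ i : Fin n, ∑ j : Fin n, V c i j * m j = dv c i) →
    ∃ (X' : Scheme.{0}) (π : X' ⟶ Spec (.of (MvPolynomial (Fin n) k ⧸ Ideal.span {f}))), IsProper π ∧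
      Literature.AlgebraicGeometry.Resolution.IsBirational π ∧
      ∀ y : X', IsDomain (X'.presheaf.stalk y) ∧ ∀ d : ℕ, ringKrullDim (X'.presheaf.stalk y) = d →
        ∀ s : Fin d → X'.presheaf.stalk y, (Ideal.span (Set.range s)).radical.IsMaximal →
          RingTheory.Sequence.IsWeaklyRegular (X'.presheaf.stalk y) (List.ofFn s) ∧
          ∀ z : X'.presheaf.stalk y, (∃ e : ℕ, z ^ p ^ e ∈
              Ideal.span ((fun w : X'.presheaf.stalk y => w ^ p ^ e) ''
                (Ideal.span (Set.range s) : Set (X'.presheaf.stalk y)))) →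
            z ∈ Ideal.span (Set.range s) := by
  intro p _ k _ _ n J hJ A hAJ hprim t ht V hV m hm a haA hgen hge hcov f hfprime hXne hoff hCN dv g hg hndiv hface
  refine cnConeFiModelRel_of_chartClause p k n J A hAJ t ht m hm hcov f hfprime hXne hoff ?_
  intro c Q _ hQ
  haveI := hfprime
  haveI : IsDomain (MvPolynomial (Fin n) k ⧸ Ideal.span {f}) := Ideal.Quotient.isDomain _
  obtain ⟨j₀, hj₀⟩ := hJ
  have hg0 : g c ≠ 0 := fun h0 => hndiv c j₀ (h0 ▸ dvd_zero _)
  -- the presentation of chart `c` (C1 prime form, landed), upgraded to a ring equivalence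
  obtain ⟨e₀, hbij, heθ⟩ := MonomialChartPresentationPrime.exists_monomialChartPresentation_of_isPrime f (V c) (hV c) (m c) (a c)
    (hgen c) A (haA c) (hge c) (dv c) (g c) (hg c) hfprime hXne (hndiv c)
  obtain ⟨e, he⟩ : ∃ e : (MvPolynomial (Fin n) k ⧸ Ideal.span {g c}) ≃+* ↥(blowupAlgebra (Ideal.span ((fun b : Fin n →₀ ℕ => Ideal.Quotient.mk (Ideal.span {f}) (MvPolynomial.monomial b (1 : k))) '' (A : Set (Fin n →₀ ℕ)))) (Ideal.Quotient.mk (Ideal.span {f}) (MvPolynomial.monomial (m c) 1))),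
      ∀ x, e x = e₀ x := ⟨RingEquiv.ofBijective e₀ hbij, fun x => rfl⟩
  -- `(g c)` is prime: `k[y]/(g c)` is isomorphic to a subring of the domain `R[1/x̄^(m c)]`
  haveI : IsDomain (Localization.Away (Ideal.Quotient.mk (Ideal.span {f}) (MvPolynomial.monomial (m c) (1 : k)))) :=
    IsLocalization.isDomain_localization
      (powers_le_nonZeroDivisors_of_noZeroDivisors (CNConeFiModel.mk_monomial_ne_zero f hXne (m c)))
  haveI : IsDomain (MvPolynomial (Fin n) k ⧸ Ideal.span {g c}) := e.toMulEquiv.isDomain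
  haveI hgp : (Ideal.span {g c}).IsPrime := (Ideal.Quotient.isDomain_iff_prime _).mp inferInstance
  -- `Q' = e⁻¹ Q` is maximal
  haveI hQ' : (Q.comap e.toRingHom).IsMaximal := Ideal.comap_isMaximal_of_equiv e
  -- every `θ(X_j)`, `j ∈ J`, lies in `Q'`: `(x̄ⱼ/1)^ε = (x̄ⱼ^ε/x̄^m) · (x̄^m/1) ∈ Q` ((prim) on `J`)
  have hXQ : ∀ j ∈ J,
      Ideal.Quotient.mk (Ideal.span {g c}) (∏ i : Fin n, MvPolynomial.X i ^ V c i j) ∈ Q.comap e.toRingHom := by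
    intro j hj
    obtain ⟨ε, hε, hεA⟩ := hprim j hj
    have hz : algebraMap (MvPolynomial (Fin n) k ⧸ Ideal.span {f}) (Localization.Away (Ideal.Quotient.mk (Ideal.span {f}) (MvPolynomial.monomial (m c) (1 : k))))
        (Ideal.Quotient.mk (Ideal.span {f}) (MvPolynomial.X j ^ ε)) * IsLocalization.Away.invSelf (Ideal.Quotient.mk (Ideal.span {f}) (MvPolynomial.monomial (m c) (1 : k))) ∈
        blowupAlgebra (Ideal.span ((fun b : Fin n →₀ ℕ => Ideal.Quotient.mk (Ideal.span {f}) (MvPolynomial.monomial b (1 : k))) '' (A : Set (Fin n →₀ ℕ)))) (Ideal.Quotient.mk (Ideal.span {f}) (MvPolynomial.monomial (m c) 1)) := by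
      refine div_mem_blowupAlgebra _ _ (Ideal.subset_span ⟨Finsupp.single j ε, hεA, ?_⟩)
      show Ideal.Quotient.mk (Ideal.span {f}) (MvPolynomial.monomial (Finsupp.single j ε) (1 : k)) = _
      rw [X_pow_eq_monomial]
    have hprod : (⟨_, hz⟩ : ↥(blowupAlgebra (Ideal.span ((fun b : Fin n →₀ ℕ => Ideal.Quotient.mk (Ideal.span {f}) (MvPolynomial.monomial b (1 : k))) '' (A : Set (Fin n →₀ ℕ)))) (Ideal.Quotient.mk (Ideal.span {f}) (MvPolynomial.monomial (m c) 1)))) *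
        algebraMap (MvPolynomial (Fin n) k ⧸ Ideal.span {f}) _ (Ideal.Quotient.mk (Ideal.span {f}) (MvPolynomial.monomial (m c) 1)) =
        (algebraMap (MvPolynomial (Fin n) k ⧸ Ideal.span {f}) _ (Ideal.Quotient.mk (Ideal.span {f}) (MvPolynomial.X j))) ^ ε := by
      apply Subtype.ext
      simp only [Subalgebra.coe_mul, Subalgebra.coe_algebraMap, SubmonoidClass.coe_pow]
      rw [← map_pow, ← map_pow]
      exact div_mul_algebraMap _ _
    have hmem : (algebraMap (MvPolynomial (Fin n) k ⧸ Ideal.span {f}) ↥(blowupAlgebra (Ideal.span ((fun b : Fin n →₀ ℕ => Ideal.Quotient.mk (Ideal.span {f}) (MvPolynomial.monomial b (1 : k))) '' (A : Set (Fin n →₀ ℕ)))) (Ideal.Quotient.mk (Ideal.span {f}) (MvPolynomial.monomial (m c) 1))) (Ideal.Quotient.mk (Ideal.span {f}) (MvPolynomial.X j))) ^ ε ∈ Q := by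
      rw [← hprod]
      exact Q.mul_mem_left _ hQ
    have hXjQ := (inferInstance : Q.IsPrime).mem_of_pow_mem _ hmem
    rw [Ideal.mem_comap]
    have hej : e.toRingHom (Ideal.Quotient.mk (Ideal.span {g c}) (∏ i : Fin n, MvPolynomial.X i ^ V c i j)) =
        algebraMap (MvPolynomial (Fin n) k ⧸ Ideal.span {f}) ↥(blowupAlgebra (Ideal.span ((fun b : Fin n →₀ ℕ => Ideal.Quotient.mk (Ideal.span {f}) (MvPolynomial.monomial b (1 : k))) '' (A : Set (Fin n →₀ ℕ)))) (Ideal.Quotient.mk (Ideal.span {f}) (MvPolynomial.monomial (m c) 1))) (Ideal.Quotient.mk (Ideal.span {f}) (MvPolynomial.X j)) := by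
      apply Subtype.ext
      rw [Subalgebra.coe_algebraMap]
      have h1 := heθ (MvPolynomial.X j)
      rw [MvPolynomial.aeval_X] at h1
      rw [RingEquiv.toRingHom_eq_coe, RingHom.coe_coe, he]
      exact h1
    rw [hej]
    exact hXjQ
  -- the clause at `Q'` (G4ᴾ-rel), transported along `k[y]/(g c)_(Q') ≅ (chart)_Q`
  have hcl := cnChartClauseRel p k n J ⟨j₀, hj₀⟩ f (V c) (hV c) (dv c) (g c) hgp (hg c) hg0
    (fun S hS => hCN c S hS) (hface c) (Q.comap e.toRingHom) hXQ
  obtain ⟨eL⟩ := BlowupFiModelOfCover.nonempty_ringEquiv_localization_of_ringEquiv e (Q.comap e.toRingHom) Q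
    (fun x => Iff.rfl)
  exact DegreeZeroDescent.inlineClause_of_ringEquiv p eL hcl

end Summit.ResolutionOfSingularities.ResolutionOfSingularities.Theorems.FInjectiveMacaulayfication.CNConeFiModelRel

end
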